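import Summits.QuantumFields.BalabanUV.T4Continuum.Support.DirichletStarSlabLayerEnergy
import Summits.QuantumFields.BalabanUV.T4Continuum.Support.RegionGaugeFixedVectorFlat

/-!
# T⁴ programme, spine node NE2 (U1a), sub-row Δ1 «NE2⁰-Dirichlet» — A KERNEL NO-GO FOR THE RENORMALISED INJECTED LAW W3̃ AT THE TORUS
# RATE: on the one-block slab the two-level defect `‖Δ_a(Ω₀)_{k+1}⁻¹·J̃_k − J̃_k·Δ_a(Ω₀)_k⁻¹‖` of the owner's renormalised pairing CANNOT be
# `O(θ^k)` for any `θ < (√L)⁻¹` — in particular not `O(L^{−k})`, the rate displayed in `towerLimitRate_star_renorm_of_sq`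

NE2 formalisation swarm `b2b-balaban-t4-ne2-formalise-*`, LEAF PROVER 02 (gen 7), supplier item «Δ1-VEC-W3̃-SLAB-NOGO» (owner ruling R29
successor item (iii) «W3/W3̃ two-level injected laws for the star towers», NEGATIVE side), file 3 of 3 (+ tools `Support/RegionNormPairingTools`), on
files 1–2 `Support/DirichletStarSlabLayer` (`J̃_k slabA_k = (√(L^d))⁻¹·(slabA_{k+1} + (√L − 1)·χ_{k+1})`, counts) and `Support/DirichletStarSlabLayerEnergy`
(energy of `slabA + c·χ` ≥ `c²(n² − σ₀⁻¹)·#col`, `‖Δ_a(Ω₀)slabA‖ ≤ a‖slabA‖`, `‖Δ_a(Ω₀)χ‖ ≤ (2√d n² + a)‖χ‖`), and on the owner's (t4-ne2-p1 gen 13)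
`Support/DirichletSubregionRenormTower` (p228571: `JnR`, `‖J̃‖ ≤ 1`) / `Support/DirichletStarRenormTower` (p228905: `nch_star_pos`; the ENDs
`towerLimitRate_star_renorm_of` / `_of_sq` DISPLAY the binder `hinj : ∀ k, ‖(Δ_a(Ω₀)_{k+1})⁻¹·J̃_k − J̃_k·(Δ_a(Ω₀)_k)⁻¹‖ ≤ C₁·θ^k`, `θ = L⁻¹`
in `_of_sq` and in leaf-07-g7's `DirichletStarClassPoincare.towerLimitRate_star_renorm_of_interior`).  `Δ_a(Ω₀)` is invertible for EVERY region
(`RegionGaugeFixedVectorFlat.isUnit_det_regionDeltaA`, leaf-07-g5), so NO coercivity / W1 hypothesis enters.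

 * §1 = `Support/RegionNormPairingTools` §2 (the PAIRING IDENTITY `Re⟨D′v′, (D′⁻¹J − JD⁻¹)(Ds)⟩ = Re⟨v′, J(Ds)⟩ − c·Re⟨v′, D′v′⟩` and its
   energy inequality `energy_le_of_pairing`);
 * §2 `Tdef` (= the matrix inside the owner's binder, verbatim), **`renorm_injected_slab_ineq`** — for EVERY level `k` (`n = L^k`, `n′ = L·n`, `3 ≤ M i`, `0 < a`, `0 < a′`):
   `L^{−1/2}(√L − 1)²·(n′² − σ₀⁻¹) ≤ a·√(n+1)·[√(n′+1) + √L − 1 + (a√(n′+1) + (√L − 1)(2√d·n′² + a))·‖T̃_k‖]`,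
   `T̃_k = (Δ_a(Ω₀)_{k+1})⁻¹·J̃_k − J̃_k·(Δ_a(Ω₀)_k)⁻¹` — an explicit, hypothesis-free inequality, and **`opNorm_Tdef_ge`** (the same solved for
   `‖T̃_k‖`: `‖T̃_k‖ ≳ (1 − L^{−1/2})∕(2a√d)·n_k^{−1/2}`);
 * §3 **`not_renorm_injected_rate (hL : 2 ≤ L) (hθ : 0 ≤ θ) (hθL : θ·√L < 1) (hinj : ∀ k, ‖T̃_k‖ ≤ C₁·θ^k) : False`**,
   **`not_renorm_injected_torus_rate : ¬ ∃ C₁, ∀ k, ‖T̃_k‖ ≤ C₁·(L⁻¹)^k`**, **`sqrt_inv_le_of_renorm_injected_rate : (√L)⁻¹ ≤ θ`**.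

READING (honest).  A no-go about ONE displayed binder (W3̃) of ONE route (the `FreeTowerLaws` resolvent route with the RENORMALISED pairing) on ONE
family of regions (thickness-one slabs, which ARE coordinate boxes and e-thin): the renormalisation `J̃ = J·diag(√(L^d∕nch))` removes King's
pairing defect (O13-d) but AMPLIFIES the outer normal layer by `√L`; since `Δ_a(Ω₀)` leaves normal components on the outer star layer free
(Bałaban's (3.16) collar does not average them at all), the planted coarse mode is `√L`× too large there and the fine propagator does not
reproduce it: the injected defect is `≍ n_k^{−1/2}`.  NOT claimed: the true convergence rate of the renormalised tower's unit-lattice images (a lower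
bound on an INPUT of a route is not a lower bound on the limit), anything about King's compressed `J` (this mode gives only `O(n_k⁻¹)` there),
anything at `U ≠ 1`, `S ≠` slab.  MODEL level (`U = 1`, one region, one averaging scale, finite torus, operator norm); statements / constants OURS
([folklore]); NE2 (U1a) NOT proved; spine 0/9 unchanged; NOT [B9] (3.16)/(3.23)–(3.27) as printed; NOT infinite volume, NOT a mass gap, NOT the Clay
problem, NOT summit progress.  HONEST DEPENDENCY: continuum YM on T⁴ ⇐ BetaPertH ∧ nine spine estimates (0/9 proved); BetaPertH ⇐ (D1) ∧ (D4) ∧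
CAP+tail; G-an2-4 gates asym, D1 and NE2/3/4.  No `sorry`.
-/

noncomputable section

open scoped BigOperators ComplexConjugate Matrix Matrix.Norms.L2Operator
open Finset Filter Topology

namespace Summit.QuantumFields.BalabanUV.T4Continuum.DirichletStarRenormSlabNoGo

open Literature.MathematicalPhysics.QuantumFieldTheory.Balaban1983to89.B5Prop11Plancherel (Tor fine)
open Literature.MathematicalPhysics.QuantumFieldTheory.Balaban1983to89.B5Prop11Lower (nsq nsq_nonneg star_dotProduct_self
  norm_star_dotProduct_le)
open Literature.MathematicalPhysics.QuantumFieldTheory.Balaban1983to89.B5G183RateUnitTower (lev)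
open Literature.MathematicalPhysics.QuantumFieldTheory.Balaban1983to89.B5Action121 (star_mulVec_dotProduct)
open Summit.QuantumFields.BalabanUV.T4Continuum
open Summit.QuantumFields.BalabanUV.T4Continuum.BalabanAveragedTowerUnit (idx cast_lev' lev_succ')
open Summit.QuantumFields.BalabanUV.T4Continuum.BalabanBlockPoincare (nsq_mulVec_le_rect)
open Summit.QuantumFields.BalabanUV.T4Continuum.ScalarBlockPoincare (nsq_smul)
open Summit.QuantumFields.BalabanUV.T4Continuum.ScalarAveragedCompression (sigma0 sigma0_pos)
open Summit.QuantumFields.BalabanUV.T4Continuum.RegionGaugeFixedVector (starReg gradR regionDeltaA)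
open Summit.QuantumFields.BalabanUV.T4Continuum.RegionGaugeFixedVectorFlat (isUnit_det_regionDeltaA)
open Summit.QuantumFields.BalabanUV.T4Continuum.DirichletSubregionTowerOf (pidx)
open Summit.QuantumFields.BalabanUV.T4Continuum.DirichletSubregionRenormTower (nch JnR opNorm_JnR_le)
open Summit.QuantumFields.BalabanUV.T4Continuum.DirichletStarVectorTower (starP regionDeltaA_isHermitian)
open Summit.QuantumFields.BalabanUV.T4Continuum.DirichletStarRenormTower (nch_star_pos)
open Summit.QuantumFields.BalabanUV.T4Continuum.DirichletDirectionalBesov (sqrt_nsq_add_le sqrt_nsq_smul)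
open Summit.QuantumFields.BalabanUV.T4Continuum.DirichletStarSlabMode
open Summit.QuantumFields.BalabanUV.T4Continuum.DirichletStarSlabLayer
open Summit.QuantumFields.BalabanUV.T4Continuum.DirichletStarSlabLayerEnergy
open Summit.QuantumFields.BalabanUV.T4Continuum.RegionNormPairingTools
open Summit.QuantumFields.BalabanUV.Beta.GAN24.DirichletBoxTrace (blockReg)

variable {d : ℕ}

/-! ## §2 The explicit inequality at every level of the slab tower -/

section Slab

variable (L : ℕ) [NeZero L] (M : Fin d → ℕ) [hM : ∀ μ, NeZero (M μ)] (i : Fin d) (a a' : ℝ)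

/-- THE TWO-LEVEL DEFECT OF THE RENORMALISED INJECTION on the slab tower: `T̃_k = (Δ_a(Ω₀)_{k+1})⁻¹·J̃_k − J̃_k·(Δ_a(Ω₀)_k)⁻¹`
(exactly the matrix inside the owner's binder `hinj`). [folklore] -/
abbrev Tdef (k : ℕ) : Matrix (pidx L M (starP L M (slabS M i)) (k + 1)) (pidx L M (starP L M (slabS M i)) k) ℂ :=
  (regionDeltaA (lev L (k + 1)) M a a' (slabS M i))⁻¹ * JnR L M (starP L M (slabS M i)) k
    - JnR L M (starP L M (slabS M i)) k * (regionDeltaA (lev L k) M a a' (slabS M i))⁻¹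

/-- **THE EXPLICIT INEQUALITY AT EVERY LEVEL** (`n = L^k`, `n′ = L·n`):
`L^{−1/2}(√L − 1)²·(n′² − σ₀⁻¹) ≤ a√(n+1)·[√(n′+1) + √L − 1 + (a√(n′+1) + (√L − 1)(2√d·n′² + a))·‖T̃_k‖]`. [folklore] -/
theorem renorm_injected_slab_ineq (hMi : 3 ≤ M i) (ha : 0 < a) (ha' : 0 < a') (k : ℕ) :
    (Real.sqrt (L : ℝ))⁻¹ * (Real.sqrt L - 1) ^ 2 * (((lev L (k + 1) : ℕ) : ℝ) ^ 2 - (sigma0 d a')⁻¹)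
      ≤ a * Real.sqrt (((lev L k : ℕ) : ℝ) + 1) *
          (Real.sqrt (((lev L (k + 1) : ℕ) : ℝ) + 1) + (Real.sqrt L - 1)
            + (a * Real.sqrt (((lev L (k + 1) : ℕ) : ℝ) + 1)
                + (Real.sqrt L - 1) * (2 * Real.sqrt d * (((lev L (k + 1) : ℕ) : ℝ)) ^ 2 + a)) * ‖Tdef L M i a a' k‖) := by
  -- abbreviations
  set S := slabS M i with hS
  set n : ℕ := lev L k with hn
  set n' : ℕ := lev L (k + 1) with hn'
  have hn'L : n' = L * n := rfl
  have hd : 0 < d := Fin.pos i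
  have hL1 : 1 ≤ L := Nat.pos_of_ne_zero (NeZero.ne L)
  have hLpos : (0 : ℝ) < L := by exact_mod_cast hL1
  have hsL : 0 < Real.sqrt (L : ℝ) := Real.sqrt_pos.mpr hLpos
  have hsL1 : 1 ≤ Real.sqrt (L : ℝ) := by rw [← Real.sqrt_one]; exact Real.sqrt_le_sqrt (by exact_mod_cast hL1)
  set D := regionDeltaA n M a a' S with hD
  set D' := regionDeltaA n' M a a' S with hD'
  set J := JnR L M (starP L M S) k with hJ
  set s := slabA n M i with hs
  set χ' := chi n' M i with hχ'
  set v' : {b // starReg n' M S b} → ℂ := slabA n' M i + (((Real.sqrt (L : ℝ) - 1 : ℝ)) : ℂ) • χ' with hv'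
  set c : ℝ := (Real.sqrt ((L : ℝ) ^ d))⁻¹ with hc
  set col : ℝ := (DirichletStarSlabLayer.col n M i : ℝ) with hcol
  set col' : ℝ := (DirichletStarSlabLayer.col n' M i : ℝ) with hcol'
  have hcolpos : 0 < col := by rw [hcol]; exact_mod_cast card_columns_pos n M i
  have hcol'eq : col' = (L : ℝ) ^ (d - 1) * col := by rw [hcol', hcol]; exact col_mul n M i L
  have hcol'pos : 0 < col' := by rw [hcol'eq]; positivity
  -- the planting identity `J s = c • v′`
  have hJs : J *ᵥ s = (c : ℂ) • v' := by rw [hJ, hs, hv', hc, hχ']; exact JnR_slabA M i L k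
  -- invertibility, Hermitian, `‖J‖ ≤ 1`
  have hU : IsUnit D.det := isUnit_det_regionDeltaA n M a a' S ha ha'
  have hU' : IsUnit D'.det := isUnit_det_regionDeltaA n' M a a' S ha ha'
  have hherm : D'.IsHermitian := regionDeltaA_isHermitian n' M a a' S
  have hJ1 : ‖J‖ ≤ 1 := opNorm_JnR_le L M (starP L M S) (nch_star_pos L M S) k
  -- `√nsq (D s) ≤ a √nsq s`
  have hDs : Real.sqrt (nsq (D *ᵥ s)) ≤ a * Real.sqrt (nsq s) := sqrt_nsq_D_slabA_le n M i a a' hMi ha.le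
  -- §1
  have key := energy_le_of_pairing hherm hU hU' hJ1 hJs hDs
  -- the energy of `v′` from below
  have hdiv : (gradR n' M S)ᴴ *ᵥ v' = fun x => ((((Real.sqrt (L : ℝ) - 1) * (n' : ℝ) : ℝ)) : ℂ) * psi n' M i x := by
    rw [hv', Matrix.mulVec_add, Matrix.mulVec_smul, gradR_conjTranspose_slabA n' M i hMi, hχ', gradR_conjTranspose_chi n' M i hMi, zero_add]
    funext x
    simp only [Pi.smul_apply, smul_eq_mul]
    push_cast; ring
  have hE := energy_ge n' M i a a' hMi ha.le ha' v' hdiv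
  rw [nsq_psi n' M i hMi] at hE
  -- the norms of `v′`, `D′v′`, `s` from above
  have hsq_slabA' : Real.sqrt (nsq (slabA n' M i)) ≤ Real.sqrt (((n' : ℝ) + 1) * col') :=
    Real.sqrt_le_sqrt (nsq_slabA_le n' M i hMi)
  have hsq_s : Real.sqrt (nsq s) ≤ Real.sqrt (((n : ℝ) + 1) * col) := Real.sqrt_le_sqrt (nsq_slabA_le n M i hMi)
  have hsq_χ' : Real.sqrt (nsq χ') = Real.sqrt col' := by rw [hχ', nsq_chi n' M i hMi]
  have hcoef : ‖(((Real.sqrt (L : ℝ) - 1 : ℝ)) : ℂ)‖ = Real.sqrt L - 1 := by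
    rw [Complex.norm_real, Real.norm_of_nonneg (by linarith)]
  have hv'le : Real.sqrt (nsq v') ≤ Real.sqrt (((n' : ℝ) + 1) * col') + (Real.sqrt L - 1) * Real.sqrt col' := by
    rw [hv']
    refine (sqrt_nsq_add_le _ _).trans ?_
    rw [sqrt_nsq_smul, hcoef, hsq_χ']
    exact add_le_add hsq_slabA' le_rfl
  have hD'v'le : Real.sqrt (nsq (D' *ᵥ v'))
      ≤ a * Real.sqrt (((n' : ℝ) + 1) * col') + (Real.sqrt L - 1) * ((2 * Real.sqrt d * (n' : ℝ) ^ 2 + a) * Real.sqrt col') := by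
    rw [hv', Matrix.mulVec_add, Matrix.mulVec_smul]
    refine (sqrt_nsq_add_le _ _).trans ?_
    rw [sqrt_nsq_smul, hcoef]
    refine add_le_add ((sqrt_nsq_D_slabA_le n' M i a a' hMi ha.le).trans (mul_le_mul_of_nonneg_left hsq_slabA' ha.le)) ?_
    refine mul_le_mul_of_nonneg_left ?_ (by linarith)
    rw [← hsq_χ']
    exact sqrt_nsq_D_chi_le n' M i a a' hMi ha.le ha'
  -- assemble: `c·E′ ≤ (√nsq v′ + √nsq(D′v′)·‖T‖)·a·√nsq s`
  set T := Tdef L M i a a' k with hTdef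
  have hT : D'⁻¹ * J - J * D⁻¹ = T := rfl
  rw [hT] at key
  have hTn : 0 ≤ ‖T‖ := norm_nonneg _
  have hc0 : 0 < c := by rw [hc]; positivity
  have hE' : ((Real.sqrt (L : ℝ) - 1) * (n' : ℝ)) ^ 2 * ((1 - (sigma0 d a')⁻¹ * ((n' : ℝ) ^ 2)⁻¹) * col')
      ≤ (star v' ⬝ᵥ (D' *ᵥ v')).re := hE
  -- lower bound of the left side of `key`
  have hlow : c * (((Real.sqrt (L : ℝ) - 1) * (n' : ℝ)) ^ 2 * ((1 - (sigma0 d a')⁻¹ * ((n' : ℝ) ^ 2)⁻¹) * col'))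
      ≤ c * (star v' ⬝ᵥ (D' *ᵥ v')).re := mul_le_mul_of_nonneg_left hE' hc0.le
  -- upper bound of the right side of `key`
  have hup : (Real.sqrt (nsq v') + Real.sqrt (nsq (D' *ᵥ v')) * ‖T‖) * (a * Real.sqrt (nsq s))
      ≤ (Real.sqrt (((n' : ℝ) + 1) * col') + (Real.sqrt L - 1) * Real.sqrt col'
          + (a * Real.sqrt (((n' : ℝ) + 1) * col') + (Real.sqrt L - 1) * ((2 * Real.sqrt d * (n' : ℝ) ^ 2 + a) * Real.sqrt col')) * ‖T‖)
        * (a * Real.sqrt (((n : ℝ) + 1) * col)) := by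
    refine mul_le_mul (add_le_add hv'le (mul_le_mul_of_nonneg_right hD'v'le hTn)) (mul_le_mul_of_nonneg_left hsq_s ha.le)
      (by positivity) ?_
    positivity
  have main := (hlow.trans key).trans hup
  -- factor `√col′` and `√col` out: `√((n′+1)col′) = √(n′+1)·√col′` etc.
  rw [Real.sqrt_mul (by positivity : (0 : ℝ) ≤ (n' : ℝ) + 1), Real.sqrt_mul (by positivity : (0 : ℝ) ≤ (n : ℝ) + 1)] at main
  have hn'pos : (0 : ℝ) < n' := by rw [hn', cast_lev']; positivity
  have hn'ne : (n' : ℝ) ≠ 0 := hn'pos.ne'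
  have hσne : sigma0 d a' ≠ 0 := (sigma0_pos (d := d) ha').ne'
  set r' := Real.sqrt col' with hr'def
  set r := Real.sqrt col with hrdef
  have hr'pos : 0 < r' := Real.sqrt_pos.mpr hcol'pos
  have hrpos : 0 < r := Real.sqrt_pos.mpr hcolpos
  have hr'r' : r' * r' = col' := Real.mul_self_sqrt hcol'pos.le
  have hsc' : r' = Real.sqrt ((L : ℝ) ^ (d - 1)) * r := by rw [hr'def, hcol'eq, Real.sqrt_mul (by positivity)]
  have hsLd : 0 < Real.sqrt ((L : ℝ) ^ (d - 1)) := Real.sqrt_pos.mpr (pow_pos hLpos _)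
  -- `c·√(L^{d−1}) = (√L)⁻¹`
  have hcL : c * Real.sqrt ((L : ℝ) ^ (d - 1)) = (Real.sqrt (L : ℝ))⁻¹ := by
    rw [hc]
    have e : (L : ℝ) ^ d = (L : ℝ) ^ (d - 1) * L := by rw [← pow_succ, Nat.sub_add_cancel hd]
    rw [e, Real.sqrt_mul (pow_nonneg hLpos.le _), mul_inv]
    field_simp
  have lhs_eq : c * (((Real.sqrt (L : ℝ) - 1) * (n' : ℝ)) ^ 2 * ((1 - (sigma0 d a')⁻¹ * ((n' : ℝ) ^ 2)⁻¹) * col'))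
      = ((Real.sqrt (L : ℝ))⁻¹ * (Real.sqrt L - 1) ^ 2 * ((n' : ℝ) ^ 2 - (sigma0 d a')⁻¹)) * (r' * r) := by
    rw [← hr'r', hsc', ← hcL]
    field_simp
  have rhs_eq : (Real.sqrt ((n' : ℝ) + 1) * r' + (Real.sqrt L - 1) * r'
        + (a * (Real.sqrt ((n' : ℝ) + 1) * r') + (Real.sqrt L - 1) * ((2 * Real.sqrt d * (n' : ℝ) ^ 2 + a) * r')) * ‖T‖)
        * (a * (Real.sqrt ((n : ℝ) + 1) * r))
      = (a * Real.sqrt ((n : ℝ) + 1) * (Real.sqrt ((n' : ℝ) + 1) + (Real.sqrt L - 1)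
          + (a * Real.sqrt ((n' : ℝ) + 1) + (Real.sqrt L - 1) * (2 * Real.sqrt d * (n' : ℝ) ^ 2 + a)) * ‖T‖)) * (r' * r) := by
    ring
  rw [lhs_eq, rhs_eq] at main
  exact le_of_mul_le_mul_right main (mul_pos hr'pos hrpos)

/-- **THE EXPLICIT LOWER BOUND** solved for `‖T̃_k‖` (`n = L^k`, `n′ = L·n`):
`[L^{−1/2}(√L−1)²(n′² − σ₀⁻¹) − a√(n+1)(√(n′+1) + √L − 1)] / [a√(n+1)·(a√(n′+1) + (√L−1)(2√d·n′² + a))] ≤ ‖T̃_k‖` — of order `n_k^{−1/2}`. [folklore] -/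
theorem opNorm_Tdef_ge (hMi : 3 ≤ M i) (ha : 0 < a) (ha' : 0 < a') (k : ℕ) :
    ((Real.sqrt (L : ℝ))⁻¹ * (Real.sqrt L - 1) ^ 2 * (((lev L (k + 1) : ℕ) : ℝ) ^ 2 - (sigma0 d a')⁻¹)
        - a * Real.sqrt (((lev L k : ℕ) : ℝ) + 1) * (Real.sqrt (((lev L (k + 1) : ℕ) : ℝ) + 1) + (Real.sqrt L - 1)))
      / (a * Real.sqrt (((lev L k : ℕ) : ℝ) + 1)
          * (a * Real.sqrt (((lev L (k + 1) : ℕ) : ℝ) + 1) + (Real.sqrt L - 1) * (2 * Real.sqrt d * (((lev L (k + 1) : ℕ) : ℝ)) ^ 2 + a)))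
      ≤ ‖Tdef L M i a a' k‖ := by
  have h := renorm_injected_slab_ineq L M i a a' hMi ha ha' k
  have hL1 : (1 : ℝ) ≤ L := by exact_mod_cast Nat.pos_of_ne_zero (NeZero.ne L)
  have hsL1 : 0 ≤ Real.sqrt (L : ℝ) - 1 := by
    rw [sub_nonneg, ← Real.sqrt_one]; exact Real.sqrt_le_sqrt hL1
  have hpos : 0 < a * Real.sqrt (((lev L k : ℕ) : ℝ) + 1)
      * (a * Real.sqrt (((lev L (k + 1) : ℕ) : ℝ) + 1) + (Real.sqrt L - 1) * (2 * Real.sqrt d * (((lev L (k + 1) : ℕ) : ℝ)) ^ 2 + a)) := by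
    have h1 : 0 < Real.sqrt (((lev L k : ℕ) : ℝ) + 1) := Real.sqrt_pos.mpr (by positivity)
    have h2 : 0 < a * Real.sqrt (((lev L (k + 1) : ℕ) : ℝ) + 1) := mul_pos ha (Real.sqrt_pos.mpr (by positivity))
    have h3 : 0 ≤ (Real.sqrt L - 1) * (2 * Real.sqrt d * (((lev L (k + 1) : ℕ) : ℝ)) ^ 2 + a) := mul_nonneg hsL1 (by positivity)
    exact mul_pos (mul_pos ha h1) (by linarith)
  rw [div_le_iff₀ hpos]
  linarith

end Slab

/-! ## §3 The no-go: no geometric rate faster than `(√L)⁻¹` -/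

section NoGo

variable (L : ℕ) [NeZero L] (M : Fin d → ℕ) [hM : ∀ μ, NeZero (M μ)] (i : Fin d) (a a' : ℝ)

/-- **W3̃ CANNOT HOLD AT ANY GEOMETRIC RATE `θ` WITH `θ·√L < 1`** on the one-block slab (`L ≥ 2`, `3 ≤ M i`, `0 < a`, `0 < a′`). [folklore] -/
theorem not_renorm_injected_rate (hL : 2 ≤ L) (hMi : 3 ≤ M i) (ha : 0 < a) (ha' : 0 < a') {θ C₁ : ℝ} (hθ : 0 ≤ θ)
    (hθL : θ * Real.sqrt L < 1) (hinj : ∀ k, ‖Tdef L M i a a' k‖ ≤ C₁ * θ ^ k) : False := by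
  have hd : 0 < d := Fin.pos i
  have hL1 : (1 : ℝ) < L := by exact_mod_cast lt_of_lt_of_le one_lt_two hL
  have hLpos : (0 : ℝ) < L := by linarith
  have hsL : 0 < Real.sqrt (L : ℝ) := Real.sqrt_pos.mpr hLpos
  have hsL1 : 1 < Real.sqrt (L : ℝ) := by rw [← Real.sqrt_one]; exact Real.sqrt_lt_sqrt zero_le_one hL1
  have hσ : 0 < sigma0 d a' := sigma0_pos (d := d) ha'
  have hC₁ : 0 ≤ C₁ := by have := (norm_nonneg _).trans (hinj 0); simpa using this
  -- constants
  set A : ℝ := (Real.sqrt (L : ℝ))⁻¹ * (Real.sqrt L - 1) ^ 2 with hA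
  have hsLm1 : 0 < Real.sqrt (L : ℝ) - 1 := by linarith
  have hApos : 0 < A := by rw [hA]; exact mul_pos (inv_pos.mpr hsL) (pow_pos hsLm1 2)
  set B : ℝ := a * Real.sqrt (2 * L) + (Real.sqrt L - 1) * (2 * Real.sqrt d * (L : ℝ) ^ 2) + (Real.sqrt L - 1) * a with hB
  have hBpos : 0 ≤ B := by
    rw [hB]
    exact add_nonneg (add_nonneg (by positivity) (mul_nonneg hsLm1.le (by positivity))) (mul_nonneg hsLm1.le ha.le)
  set K₁ : ℝ := a * Real.sqrt 2 * (Real.sqrt (2 * L) + Real.sqrt L) with hK₁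
  set K₂ : ℝ := a * Real.sqrt 2 * B * C₁ with hK₂
  -- the level variable `x_k = L^k`
  have hx : ∀ k : ℕ, (1 : ℝ) ≤ (L : ℝ) ^ k := fun k => one_le_pow₀ hL1.le
  -- from the explicit inequality: `A·L²·x² ≤ A·σ₀⁻¹ + K₁·x + K₂·θ^k·x^{5/2}` with `x = L^k`, hence after dividing by `x²`:
  have step : ∀ k : ℕ, A * (L : ℝ) ^ 2 ≤ A * (sigma0 d a')⁻¹ * (((L : ℝ) ^ k) ^ 2)⁻¹ + K₁ * ((L : ℝ) ^ k)⁻¹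
      + K₂ * (θ * Real.sqrt L) ^ k := by
    intro k
    have h := renorm_injected_slab_ineq L M i a a' hMi ha ha' k
    rw [cast_lev' L (k + 1), cast_lev' L k] at h
    set x : ℝ := (L : ℝ) ^ k with hxdef
    have hx1 : 1 ≤ x := hx k
    have hxpos : 0 < x := by linarith
    have hLx : (L : ℝ) ^ (k + 1) = L * x := by rw [pow_succ, mul_comm]
    rw [hLx] at h
    -- crude bounds `√(x+1) ≤ √2·√x`, `√(Lx+1) ≤ √(2L)·√x`, `√x ≤ x ≤ x²`
    have hsx : 0 < Real.sqrt x := Real.sqrt_pos.mpr hxpos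
    have hsx1 : 1 ≤ Real.sqrt x := by rw [← Real.sqrt_one]; exact Real.sqrt_le_sqrt hx1
    have b1 : Real.sqrt (x + 1) ≤ Real.sqrt 2 * Real.sqrt x := by
      rw [← Real.sqrt_mul (by norm_num)]; exact Real.sqrt_le_sqrt (by linarith)
    have hLx1 : 1 ≤ (L : ℝ) * x := by nlinarith
    have b2 : Real.sqrt (L * x + 1) ≤ Real.sqrt (2 * L) * Real.sqrt x := by
      rw [← Real.sqrt_mul (by positivity)]; exact Real.sqrt_le_sqrt (by linarith)
    have b3 : Real.sqrt x ≤ x := by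
      have h := le_mul_of_one_le_left hsx.le hsx1
      rwa [Real.mul_self_sqrt hxpos.le] at h
    have hx2ge : 1 ≤ x ^ 2 := one_le_pow₀ hx1
    have b4 : x ≤ x ^ 2 := by nlinarith
    have b34 : Real.sqrt x ≤ x ^ 2 := b3.trans b4
    have hT := hinj k
    have hTn : 0 ≤ ‖Tdef L M i a a' k‖ := norm_nonneg _
    have hθk : 0 ≤ θ ^ k := pow_nonneg hθ k
    -- bound the bracket `[…]` of `h`
    have hbr1 : Real.sqrt (L * x + 1) + (Real.sqrt L - 1) ≤ (Real.sqrt (2 * L) + Real.sqrt L) * Real.sqrt x := by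
      have t : Real.sqrt (L : ℝ) ≤ Real.sqrt L * Real.sqrt x := le_mul_of_one_le_right hsL.le hsx1
      have e : (Real.sqrt (2 * L) + Real.sqrt L) * Real.sqrt x = Real.sqrt (2 * L) * Real.sqrt x + Real.sqrt L * Real.sqrt x := by ring
      rw [e]; linarith
    have t1 : a * Real.sqrt (L * x + 1) ≤ a * Real.sqrt (2 * L) * x ^ 2 := by
      calc a * Real.sqrt (L * x + 1) ≤ a * (Real.sqrt (2 * L) * Real.sqrt x) := mul_le_mul_of_nonneg_left b2 ha.le
        _ ≤ a * (Real.sqrt (2 * L) * x ^ 2) := mul_le_mul_of_nonneg_left (mul_le_mul_of_nonneg_left b34 (Real.sqrt_nonneg _)) ha.le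
        _ = a * Real.sqrt (2 * L) * x ^ 2 := by ring
    have t2 : (Real.sqrt L - 1) * (2 * Real.sqrt d * (L * x) ^ 2 + a)
        ≤ (Real.sqrt L - 1) * (2 * Real.sqrt d * (L : ℝ) ^ 2) * x ^ 2 + (Real.sqrt L - 1) * a * x ^ 2 := by
      have h0 : 0 ≤ (Real.sqrt L - 1) * a := mul_nonneg hsLm1.le ha.le
      have t2a : (Real.sqrt L - 1) * a ≤ (Real.sqrt L - 1) * a * x ^ 2 := le_mul_of_one_le_right h0 hx2ge
      have e : (Real.sqrt L - 1) * (2 * Real.sqrt d * (L * x) ^ 2 + a)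
          = (Real.sqrt L - 1) * (2 * Real.sqrt d * (L : ℝ) ^ 2) * x ^ 2 + (Real.sqrt L - 1) * a := by ring
      rw [e]; linarith
    have hbr2 : a * Real.sqrt (L * x + 1) + (Real.sqrt L - 1) * (2 * Real.sqrt d * (L * x) ^ 2 + a) ≤ B * x ^ 2 := by
      have e : B * x ^ 2 = a * Real.sqrt (2 * L) * x ^ 2 + ((Real.sqrt L - 1) * (2 * Real.sqrt d * (L : ℝ) ^ 2) * x ^ 2
          + (Real.sqrt L - 1) * a * x ^ 2) := by rw [hB]; ring
      rw [e]; linarith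
    have hbr : Real.sqrt (L * x + 1) + (Real.sqrt L - 1)
        + (a * Real.sqrt (L * x + 1) + (Real.sqrt L - 1) * (2 * Real.sqrt d * (L * x) ^ 2 + a)) * ‖Tdef L M i a a' k‖
        ≤ (Real.sqrt (2 * L) + Real.sqrt L) * Real.sqrt x + B * x ^ 2 * (C₁ * θ ^ k) := by
      have := mul_le_mul hbr2 hT hTn (by positivity)
      linarith [hbr1, this]
    have hpre : 0 ≤ a * Real.sqrt (x + 1) := by positivity
    have h2 : A * ((L * x) ^ 2 - (sigma0 d a')⁻¹)
        ≤ a * Real.sqrt (x + 1) * ((Real.sqrt (2 * L) + Real.sqrt L) * Real.sqrt x + B * x ^ 2 * (C₁ * θ ^ k)) :=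
      h.trans (mul_le_mul_of_nonneg_left hbr hpre)
    have h3 : a * Real.sqrt (x + 1) * ((Real.sqrt (2 * L) + Real.sqrt L) * Real.sqrt x + B * x ^ 2 * (C₁ * θ ^ k))
        ≤ K₁ * x + K₂ * θ ^ k * (Real.sqrt x * x ^ 2) := by
      have e1 : Real.sqrt x * Real.sqrt x = x := Real.mul_self_sqrt hxpos.le
      have t3 : a * Real.sqrt (x + 1) ≤ a * (Real.sqrt 2 * Real.sqrt x) := mul_le_mul_of_nonneg_left b1 ha.le
      have g0 : 0 ≤ (Real.sqrt (2 * L) + Real.sqrt L) * Real.sqrt x + B * x ^ 2 * (C₁ * θ ^ k) := by positivity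
      calc a * Real.sqrt (x + 1) * ((Real.sqrt (2 * L) + Real.sqrt L) * Real.sqrt x + B * x ^ 2 * (C₁ * θ ^ k))
          ≤ a * (Real.sqrt 2 * Real.sqrt x) * ((Real.sqrt (2 * L) + Real.sqrt L) * Real.sqrt x + B * x ^ 2 * (C₁ * θ ^ k)) :=
            mul_le_mul_of_nonneg_right t3 g0
        _ = a * Real.sqrt 2 * (Real.sqrt (2 * L) + Real.sqrt L) * (Real.sqrt x * Real.sqrt x)
            + a * Real.sqrt 2 * B * C₁ * θ ^ k * (Real.sqrt x * x ^ 2) := by ring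
        _ = K₁ * x + K₂ * θ ^ k * (Real.sqrt x * x ^ 2) := by rw [e1, hK₁, hK₂]
    have h4 : A * ((L * x) ^ 2 - (sigma0 d a')⁻¹) ≤ K₁ * x + K₂ * θ ^ k * (Real.sqrt x * x ^ 2) := h2.trans h3
    -- divide by `x²`; `√x = (√L)^k`
    have hsxk : Real.sqrt x = Real.sqrt L ^ k := by
      rw [hxdef, show ((L : ℝ) ^ k) = (Real.sqrt (L : ℝ) ^ k) ^ 2 by rw [← pow_mul, mul_comm, pow_mul, Real.sq_sqrt hLpos.le],
        Real.sqrt_sq (pow_nonneg hsL.le k)]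
    have hx2 : 0 < x ^ 2 := by positivity
    have hxne : x ≠ 0 := hxpos.ne'
    have h5 : A * (L : ℝ) ^ 2 - A * (sigma0 d a')⁻¹ * (x ^ 2)⁻¹ ≤ K₁ * x⁻¹ + K₂ * (θ * Real.sqrt L) ^ k := by
      have h6 := div_le_div_of_nonneg_right h4 hx2.le
      have e3 : A * ((L * x) ^ 2 - (sigma0 d a')⁻¹) / x ^ 2 = A * (L : ℝ) ^ 2 - A * (sigma0 d a')⁻¹ * (x ^ 2)⁻¹ := by
        field_simp
      have e4 : (K₁ * x + K₂ * θ ^ k * (Real.sqrt x * x ^ 2)) / x ^ 2 = K₁ * x⁻¹ + K₂ * (θ * Real.sqrt L) ^ k := by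
        rw [mul_pow, ← hsxk]
        field_simp
      rwa [e3, e4] at h6
    have h7 : 0 ≤ A * (sigma0 d a')⁻¹ * (x ^ 2)⁻¹ := by positivity
    rw [hxdef] at h5 h7
    linarith [h5, h7]
  -- the right side tends to `0`, the left side is the positive constant `A·L²`
  have hlim : Tendsto (fun k : ℕ => A * (sigma0 d a')⁻¹ * (((L : ℝ) ^ k) ^ 2)⁻¹ + K₁ * ((L : ℝ) ^ k)⁻¹ + K₂ * (θ * Real.sqrt L) ^ k)
      atTop (𝓝 0) := by
    have t0 : Tendsto (fun k : ℕ => ((L : ℝ) ^ k)⁻¹) atTop (𝓝 0) := by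
      simp_rw [← inv_pow]
      exact tendsto_pow_atTop_nhds_zero_of_lt_one (inv_nonneg.mpr hLpos.le) (inv_lt_one_of_one_lt₀ hL1)
    have t1 : Tendsto (fun k : ℕ => (((L : ℝ) ^ k) ^ 2)⁻¹) atTop (𝓝 0) := by
      have := t0.pow 2
      simp only [zero_pow two_ne_zero, inv_pow] at this ⊢
      exact this
    have t2 : Tendsto (fun k : ℕ => (θ * Real.sqrt L) ^ k) atTop (𝓝 0) :=
      tendsto_pow_atTop_nhds_zero_of_lt_one (by positivity) hθL
    have := ((t1.const_mul (A * (sigma0 d a')⁻¹)).add (t0.const_mul K₁)).add (t2.const_mul K₂)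
    simpa using this
  have hAL : 0 < A * (L : ℝ) ^ 2 := by positivity
  obtain ⟨k, hk⟩ := (hlim.eventually (gt_mem_nhds hAL)).exists
  exact absurd (step k) (not_le.mpr hk)

/-- **IN PARTICULAR NOT AT THE TORUS RATE `L⁻¹`** — the binder `hinj` of `DirichletStarRenormTower.towerLimitRate_star_renorm_of_sq` /
`DirichletStarClassPoincare.towerLimitRate_star_renorm_of_interior` is NOT inhabitable on the one-block slab. [folklore] -/
theorem not_renorm_injected_torus_rate (hL : 2 ≤ L) (hMi : 3 ≤ M i) (ha : 0 < a) (ha' : 0 < a') :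
    ¬ ∃ C₁ : ℝ, ∀ k, ‖(regionDeltaA (lev L (k + 1)) M a a' (slabS M i))⁻¹ * JnR L M (starP L M (slabS M i)) k
        - JnR L M (starP L M (slabS M i)) k * (regionDeltaA (lev L k) M a a' (slabS M i))⁻¹‖ ≤ C₁ * ((L : ℝ)⁻¹) ^ k := by
  rintro ⟨C₁, hC⟩
  have hL1 : (1 : ℝ) < L := by exact_mod_cast lt_of_lt_of_le one_lt_two hL
  have hLpos : (0 : ℝ) < L := by linarith
  have hθL : (L : ℝ)⁻¹ * Real.sqrt L < 1 := by
    have hs : Real.sqrt (L : ℝ) < L := by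
      nlinarith [Real.mul_self_sqrt hLpos.le, Real.sqrt_nonneg (L : ℝ),
        show 1 < Real.sqrt (L : ℝ) by rw [← Real.sqrt_one]; exact Real.sqrt_lt_sqrt zero_le_one hL1]
    rw [inv_mul_lt_iff₀ hLpos]; linarith
  exact not_renorm_injected_rate L M i a a' hL hMi ha ha' (inv_nonneg.mpr hLpos.le) hθL hC

/-- **THE RATE OF ANY INHABITANT OF W3̃ ON THE SLAB IS AT LEAST `(√L)⁻¹`**. [folklore] -/
theorem sqrt_inv_le_of_renorm_injected_rate (hL : 2 ≤ L) (hMi : 3 ≤ M i) (ha : 0 < a) (ha' : 0 < a') {θ C₁ : ℝ} (hθ : 0 ≤ θ)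
    (hinj : ∀ k, ‖(regionDeltaA (lev L (k + 1)) M a a' (slabS M i))⁻¹ * JnR L M (starP L M (slabS M i)) k
        - JnR L M (starP L M (slabS M i)) k * (regionDeltaA (lev L k) M a a' (slabS M i))⁻¹‖ ≤ C₁ * θ ^ k) :
    (Real.sqrt (L : ℝ))⁻¹ ≤ θ := by
  have hLpos : (0 : ℝ) < L := by exact_mod_cast lt_of_lt_of_le two_pos hL
  have hsL : 0 < Real.sqrt (L : ℝ) := Real.sqrt_pos.mpr hLpos
  by_contra h
  have hθL : θ * Real.sqrt L < 1 := by
    rw [not_le] at h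
    calc θ * Real.sqrt L < (Real.sqrt (L : ℝ))⁻¹ * Real.sqrt L := mul_lt_mul_of_pos_right h hsL
      _ = 1 := inv_mul_cancel₀ hsL.ne'
  exact not_renorm_injected_rate L M i a a' hL hMi ha ha' hθ hθL hinj

end NoGo

end Summit.QuantumFields.BalabanUV.T4Continuum.DirichletStarRenormSlabNoGo

end
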